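import Literature.MathematicalPhysics.QuantumFieldTheory.YangMillsOS

/-!
# Negative note for line `Sketch` (af-staircase) of crux stmt-QuantumFields-8761: why the r0 heart
was reshaped into the ladder form r1

`staircase_r0_false_of_bulkCoexistence`: for a fixed gauge group `G` and lattice representation
`r`, the r0 staircase (rungs asserted for EVERY landing point `β + δ > 0`) is refuted by the
following two pieces of data at one coupling `βt > 0` — the signature of an isolated first-order
bulk transition on the Wilson axis of `(G, r)`:

* (massive phase below `βt`) for every `0 < δ ≤ βt` the torus Wilson states at `βt − δ` cluster on
  all large tori in the SC currency with some rate `m ∈ (0, 1]` and prefactor `K ≥ 2`;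
* (phase coexistence at `βt`) some species `A` has connected auto-correlation at the maximal
  admissible separation `2S` on the tori `(4S+1)⁴` bounded BELOW by a fixed `ε > 0` for all large
  `S` (the symmetric-torus state at `βt` is a non-trivial mixture of the coexisting phases).

Neither piece is constructed here (no first-order transition of a 4-D lattice gauge theory with a
continuous gauge group is rigorously established); the lemma is the kernel-checked form of the
lead's reason for reshape r1 (crux `NOTES.md` §8): the r0 rung from `βt − δ` INTO `βt` would
transport the clustering below `βt` to exponential decay at `βt`, contradicting coexistence.
The r1 heart only asserts rungs whose landing point is a ladder point or lies above `β⋆`, so this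
obstruction does not touch it.
-/

noncomputable section

open scoped BigOperators Topology
open MeasureTheory ProbabilityTheory Filter
open Literature.MathematicalPhysics.QuantumFieldTheory Literature.MathematicalPhysics.QuantumLattice

namespace Summit.QuantumFields.YangMills.Cruxes.LatticeGapLargeBeta.AfStaircase

/-- If `0 < κ` then `C · e^{−κ S} < ε` for all large natural `S` (`ε > 0`). [folklore] -/
theorem exists_nat_mul_exp_neg_lt {C κ ε : ℝ} (hκ : 0 < κ) (hε : 0 < ε) :
    ∃ N : ℕ, ∀ S : ℕ, N ≤ S → C * Real.exp (-(κ * S)) < ε := by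
  obtain ⟨N, hN⟩ := exists_nat_gt (Real.log (C / ε) / κ)
  refine ⟨N, fun S hS => ?_⟩
  have hS' : Real.log (C / ε) / κ < S := hN.trans_le (by exact_mod_cast hS)
  have h1 : Real.log (C / ε) < κ * S := by rwa [div_lt_iff₀ hκ, mul_comm] at hS'
  by_cases hC : C ≤ 0
  · exact lt_of_le_of_lt (mul_nonpos_of_nonpos_of_nonneg hC (Real.exp_pos _).le) hε
  · push Not at hC
    have h2 : C / ε < Real.exp (κ * S) := by
      rw [← Real.exp_log (div_pos hC hε)]
      exact Real.exp_lt_exp.2 h1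
    rw [div_lt_iff₀ hε] at h2
    rw [Real.exp_neg]
    have h3 : 0 < Real.exp (κ * S) := Real.exp_pos _
    rw [mul_inv_lt_iff₀ h3]
    linarith [mul_comm ε (Real.exp (κ * ↑S))]

/-- **The r0 staircase is incompatible with an isolated first-order bulk point.**  For fixed
`G, r` and a coupling `βt > 0`: if (i) for every `0 < δ ≤ βt` the torus Wilson states at `βt − δ`
cluster on all large tori in the SC currency (rate `m ∈ (0,1]`, prefactor `K ≥ 2`) and (ii) some
species `A` has `|corr_{βt, 4S+1}(A, A, 2S)| ≥ ε > 0` for all large `S`, then the r0 staircase for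
`r` (rungs asserted for EVERY landing point) is false: the rung from `βt − δ`, `δ = min Δβ βt`,
would give `|corr_{βt,4S+1}(A,A,2S)| ≤ cK a² e^{2θmw} e^{−2θmS} → 0`. [folklore] -/
theorem staircase_r0_false_of_bulkCoexistence
    (G : Type) [Group G] [TopologicalSpace G] [IsTopologicalGroup G] [CompactSpace G]
    [MeasurableSpace G] [BorelSpace G] (r : LatticeRep G) (βt : ℝ) (hβt : 0 < βt)
    (hbelow : ∀ δ : ℝ, 0 < δ → δ ≤ βt → ∃ (m K : ℝ) (S₀ : ℕ), 0 < m ∧ m ≤ 1 ∧ 2 ≤ K ∧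
      ∀ S : ℕ, S₀ ≤ S →
      ∀ (A B : YMSpecies G) (a b : ℝ) (w : ℕ), (∀ U, |A.F U| ≤ a) → (∀ U, |B.F U| ≤ b) →
        (∀ e ∈ A.supp, |e.1 0| ≤ (w : ℤ)) → (∀ e ∈ B.supp, |e.1 0| ≤ (w : ℤ)) →
        ∀ n : ℕ, n ≤ S →
          |latticeConnectedCorr r.ρ (βt - δ) (2 * S + 1) A.F B.F n| ≤
            K * a * b * Real.exp (m * (2 * w)) * Real.exp (-(m * n)))
    (hcoex : ∃ (A : YMSpecies G) (ε : ℝ), 0 < ε ∧ ∃ S₁ : ℕ, ∀ S : ℕ, S₁ ≤ S →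
      ε ≤ |latticeConnectedCorr r.ρ βt (2 * (2 * S) + 1) A.F A.F (2 * S)|) :
    ¬ (∃ (Δβ θ c : ℝ) (L₀ : ℝ → ℕ), 0 < Δβ ∧ 0 < θ ∧ θ ≤ 1 ∧ 1 ≤ c ∧
      ∀ β : ℝ, 0 ≤ β → ∀ δ : ℝ, 0 < δ → δ ≤ Δβ → ∀ S : ℕ, L₀ β ≤ S →
      ∀ m K : ℝ, 0 < m → m ≤ 1 → 2 ≤ K →
        (∀ (A B : YMSpecies G) (a b : ℝ) (w : ℕ), (∀ U, |A.F U| ≤ a) → (∀ U, |B.F U| ≤ b) →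
          (∀ e ∈ A.supp, |e.1 0| ≤ (w : ℤ)) → (∀ e ∈ B.supp, |e.1 0| ≤ (w : ℤ)) →
          ∀ n : ℕ, n ≤ S →
            |latticeConnectedCorr r.ρ β (2 * S + 1) A.F B.F n| ≤
              K * a * b * Real.exp (m * (2 * w)) * Real.exp (-(m * n))) →
        (∀ (A B : YMSpecies G) (a b : ℝ) (w : ℕ), (∀ U, |A.F U| ≤ a) → (∀ U, |B.F U| ≤ b) →
          (∀ e ∈ A.supp, |e.1 0| ≤ (w : ℤ)) → (∀ e ∈ B.supp, |e.1 0| ≤ (w : ℤ)) →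
          ∀ n : ℕ, n ≤ 2 * S →
            |latticeConnectedCorr r.ρ (β + δ) (2 * (2 * S) + 1) A.F B.F n| ≤
              c * K * a * b * Real.exp (θ * m * (2 * w)) * Real.exp (-(θ * m * n))) ∧
        (∀ (A B : YMSpecies G) (a b : ℝ) (w : ℕ), (∀ U, |A.F U| ≤ a) → (∀ U, |B.F U| ≤ b) →
          (∀ e ∈ A.supp, |e.1 0| ≤ (w : ℤ)) → (∀ e ∈ B.supp, |e.1 0| ≤ (w : ℤ)) →
          ∀ n : ℕ, n ≤ 2 * S + 1 →
            |latticeConnectedCorr r.ρ (β + δ) (2 * (2 * S + 1) + 1) A.F B.F n| ≤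
              c * K * a * b * Real.exp (θ * m * (2 * w)) * Real.exp (-(θ * m * n)))) := by
  rintro ⟨Δβ, θ, c, L₀, hΔ, hθ, _hθ1, _hc, hstep⟩
  obtain ⟨A, ε, hε, S₁, hcoex⟩ := hcoex
  -- the step `δ = min Δβ βt` from `β = βt − δ ≥ 0` lands at `βt`
  set δ : ℝ := min Δβ βt with hδ
  have hδ0 : 0 < δ := lt_min hΔ hβt
  have hδΔ : δ ≤ Δβ := min_le_left _ _
  have hδt : δ ≤ βt := min_le_right _ _
  have hβ0 : 0 ≤ βt - δ := by linarith
  obtain ⟨m, K, S₀, hm, hm1, hK, hSC⟩ := hbelow δ hδ0 hδt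
  -- data of the species `A`
  obtain ⟨a, ha⟩ := A.bounded
  set w : ℕ := A.supp.sup fun e => (e.1 0).natAbs with hw
  have hwA : ∀ e ∈ A.supp, |e.1 0| ≤ (w : ℤ) := fun e he => by
    have h1 : (e.1 0).natAbs ≤ w := Finset.le_sup (f := fun e => (e.1 0).natAbs) he
    calc |e.1 0| = ((e.1 0).natAbs : ℤ) := (Int.natCast_natAbs _).symm
      _ ≤ (w : ℤ) := by exact_mod_cast h1
  -- the rung's bound at separation `2S` tends to `0`
  have hκ : 0 < 2 * (θ * m) := by positivity
  obtain ⟨N, hN⟩ := exists_nat_mul_exp_neg_lt (C := c * K * a * a * Real.exp (θ * m * (2 * w)))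
    hκ hε
  -- a large torus where everything applies
  set S : ℕ := max (max S₀ (L₀ (βt - δ))) (max S₁ N) with hS
  have hS0 : S₀ ≤ S := (le_max_left _ _).trans (le_max_left _ _)
  have hSL : L₀ (βt - δ) ≤ S := (le_max_right _ _).trans (le_max_left _ _)
  have hS1 : S₁ ≤ S := (le_max_left _ _).trans (le_max_right _ _)
  have hSN : N ≤ S := (le_max_right _ _).trans (le_max_right _ _)
  have hrung := (hstep (βt - δ) hβ0 δ hδ0 hδΔ S hSL m K hm hm1 hK (hSC S hS0)).1
    A A a a w ha ha hwA hwA (2 * S) le_rfl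
  have heq : βt - δ + δ = βt := by ring
  rw [heq] at hrung
  have hlow := hcoex S hS1
  have hsmall := hN S hSN
  have hcast : c * K * a * a * Real.exp (θ * m * (2 * (w : ℝ))) * Real.exp (-(θ * m * ((2 * S : ℕ) : ℝ))) =
      c * K * a * a * Real.exp (θ * m * (2 * (w : ℝ))) * Real.exp (-(2 * (θ * m) * (S : ℝ))) := by
    push_cast; ring_nf
  rw [hcast] at hrung
  linarith

end Summit.QuantumFields.YangMills.Cruxes.LatticeGapLargeBeta.AfStaircase

end
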